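import Summits.Ventures.PercRepro.C025ProfilePLDSimplePaving

/-!
# PER-LAYER DOMINANCE REDUCES TO SIMPLE MATROIDS (night-3 g30)

`proofs/NIGHT3-G30-PAREXT.md` §4.  A loop `e` doubles the profile: `profile(M) = 2·profile(M ＼ {e})` (`sum_powerset_loop`), so
(PLD) passes from `M ＼ {e}` to `M` (`pld_of_loop`); a parallel pair passes (PLD) from `M ＼ {e'}` and `(M ＼ {e'}) ／ {e}` to `M`
(`pld_of_parallel`).  Hence, by the parallel-extension induction principle with the trivial class and an inner induction
removing loops, PER-LAYER DOMINANCE FOR EVERY FINITE MATROID FOLLOWS FROM PER-LAYER DOMINANCE FOR EVERY FINITE SIMPLE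
MATROID — no loops, no 2-circuits (`pld_of_simple`).  The cell's (PLD) conjecture is therefore a statement about simple
matroids.  No `def`, no `instance`, no notation.  Axioms: standard.
-/

open scoped Matroid

namespace PercRepro

open Finset ThmH

namespace PLDParExt

variable {α : Type} [DecidableEq α]

/-- A LOOP DOUBLES THE PROFILE: for a loop `e` of a finite matroid `M` and every function `F` of the rank pair,
`Σ_{I ⊆ E} F(ρI, ρ(E∖I)) = 2·Σ_{J ⊆ E−e} F(ρ_N J, ρ_N(E−e−J))` with `N = M ＼ {e}`. -/
theorem sum_powerset_loop (M : Matroid α) [M.Finite] {e : α} (he : M.IsLoop e) (F : ℕ → ℕ → ℕ) :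
    ∑ I ∈ (gr M).powerset, F (M.eRk (I : Set α)).toNat (M.eRk ((gr M \ I : Finset α) : Set α)).toNat =
      2 * ∑ J ∈ (gr (M ＼ {e})).powerset,
          F ((M ＼ {e}).eRk (J : Set α)).toNat ((M ＼ {e}).eRk ((gr (M ＼ {e}) \ J : Finset α) : Set α)).toNat := by
  set K : Finset α := (gr M).erase e with hK
  have heM : e ∈ gr M := by rw [← Finset.mem_coe, coe_gr]; exact he.mem_ground
  have heK : e ∉ K := Finset.notMem_erase e _
  have hgrN : gr (M ＼ {e}) = K := gr_delete_singleton M e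
  have hgrM : gr M = insert e K := by rw [hK, Finset.insert_erase heM]
  have hKE : (K : Set α) ⊆ M.E \ {e} := by
    intro x hx
    rw [Finset.mem_coe, hK, Finset.mem_erase, ← Finset.mem_coe, coe_gr] at hx
    exact ⟨hx.2, hx.1⟩
  rw [hgrM, hgrN, Finset.sum_powerset_insert heK, Finset.mul_sum, ← Finset.sum_add_distrib]
  refine Finset.sum_congr rfl fun I₀ hI₀ => ?_
  have hIK : I₀ ⊆ K := Finset.mem_powerset.1 hI₀
  have heI : e ∉ I₀ := fun h => heK (hIK h)
  have c1 : insert e K \ I₀ = insert e (K \ I₀) := Finset.insert_sdiff_of_notMem _ heI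
  have c2 : insert e K \ insert e I₀ = K \ I₀ := by
    rw [Finset.insert_sdiff_insert, Finset.sdiff_insert,
      Finset.erase_eq_of_notMem (fun h => heK (Finset.mem_sdiff.1 h).1)]
  rw [c1, c2]
  simp only [Finset.coe_insert]
  have hIE : (I₀ : Set α) ⊆ M.E \ {e} := fun x hx => hKE (hIK hx)
  have hKIE : ((K \ I₀ : Finset α) : Set α) ⊆ M.E \ {e} := fun x hx => hKE (Finset.mem_sdiff.1 hx).1
  rw [eRk_insert_of_mem_closure M (he.mem_closure _), eRk_insert_of_mem_closure M (he.mem_closure _),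
    eRk_delete_of_subset M {e} _ hIE, eRk_delete_of_subset M {e} _ hKIE]
  ring

/-- (PLD) passes from `M ＼ {e}` to `M` for a loop `e`. -/
theorem pld_of_loop (M : Matroid α) [M.Finite] {e : α} (he : M.IsLoop e)
    (hN : ∀ lo hi δ Θ : ℕ, Θ ≤ lo + hi + δ → (lo = 0 ∨ lo + hi + δ ≤ Θ) →
      (∑ I ∈ (gr (M ＼ {e})).powerset, (if lo ≤ ((M ＼ {e}).eRk (I : Set α)).toNat ∧
          ((M ＼ {e}).eRk (I : Set α)).toNat ≤ hi ∧
          Θ ≤ ((M ＼ {e}).eRk ((gr (M ＼ {e}) \ I : Finset α) : Set α)).toNat +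
            ((M ＼ {e}).eRk (I : Set α)).toNat then
          (((M ＼ {e}).eRk ((gr (M ＼ {e}) \ I : Finset α) : Set α)).toNat).choose δ else 0)) ≤
        ∑ I ∈ (gr (M ＼ {e})).powerset, (if lo + δ ≤ ((M ＼ {e}).eRk ((gr (M ＼ {e}) \ I : Finset α) : Set α)).toNat ∧
          ((M ＼ {e}).eRk ((gr (M ＼ {e}) \ I : Finset α) : Set α)).toNat ≤ hi + δ then
          (((M ＼ {e}).eRk ((gr (M ＼ {e}) \ I : Finset α) : Set α)).toNat).choose δ else 0)) :
    ∀ lo hi δ Θ : ℕ, Θ ≤ lo + hi + δ → (lo = 0 ∨ lo + hi + δ ≤ Θ) →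
      (∑ I ∈ (gr M).powerset, (if lo ≤ (M.eRk (I : Set α)).toNat ∧ (M.eRk (I : Set α)).toNat ≤ hi ∧
          Θ ≤ (M.eRk ((gr M \ I : Finset α) : Set α)).toNat + (M.eRk (I : Set α)).toNat then
          ((M.eRk ((gr M \ I : Finset α) : Set α)).toNat).choose δ else 0)) ≤
        ∑ I ∈ (gr M).powerset, (if lo + δ ≤ (M.eRk ((gr M \ I : Finset α) : Set α)).toNat ∧
          (M.eRk ((gr M \ I : Finset α) : Set α)).toNat ≤ hi + δ then
          ((M.eRk ((gr M \ I : Finset α) : Set α)).toNat).choose δ else 0) := by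
  intro lo hi δ Θ hΘ hlo
  have hL := sum_powerset_loop M he (fun x f => if lo ≤ x ∧ x ≤ hi ∧ Θ ≤ f + x then f.choose δ else 0)
  have hR := sum_powerset_loop M he (fun x f => if lo + δ ≤ f ∧ f ≤ hi + δ then f.choose δ else 0)
  beta_reduce at hL hR
  rw [hL, hR]
  have h1 := hN lo hi δ Θ hΘ hlo
  omega

/-- PER-LAYER DOMINANCE REDUCES TO SIMPLE MATROIDS: if every finite matroid without loops and without 2-circuits
satisfies the hPLD binder of `PLDBridge.rls_disjointSum_freeOn_of_pld`, then every finite matroid does. -/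
theorem pld_of_simple
    (hsimple : ∀ (M : Matroid α) [M.Finite], (∀ e, ¬ M.IsLoop e) → (¬ ∃ e e' : α, e ≠ e' ∧ M.IsCircuit {e, e'}) →
      ∀ lo hi δ Θ : ℕ, Θ ≤ lo + hi + δ → (lo = 0 ∨ lo + hi + δ ≤ Θ) →
      (∑ I ∈ (gr M).powerset, (if lo ≤ (M.eRk (I : Set α)).toNat ∧ (M.eRk (I : Set α)).toNat ≤ hi ∧
          Θ ≤ (M.eRk ((gr M \ I : Finset α) : Set α)).toNat + (M.eRk (I : Set α)).toNat then
          ((M.eRk ((gr M \ I : Finset α) : Set α)).toNat).choose δ else 0)) ≤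
        ∑ I ∈ (gr M).powerset, (if lo + δ ≤ (M.eRk ((gr M \ I : Finset α) : Set α)).toNat ∧
          (M.eRk ((gr M \ I : Finset α) : Set α)).toNat ≤ hi + δ then
          ((M.eRk ((gr M \ I : Finset α) : Set α)).toNat).choose δ else 0))
    (M : Matroid α) [M.Finite] :
    ∀ lo hi δ Θ : ℕ, Θ ≤ lo + hi + δ → (lo = 0 ∨ lo + hi + δ ≤ Θ) →
      (∑ I ∈ (gr M).powerset, (if lo ≤ (M.eRk (I : Set α)).toNat ∧ (M.eRk (I : Set α)).toNat ≤ hi ∧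
          Θ ≤ (M.eRk ((gr M \ I : Finset α) : Set α)).toNat + (M.eRk (I : Set α)).toNat then
          ((M.eRk ((gr M \ I : Finset α) : Set α)).toNat).choose δ else 0)) ≤
        ∑ I ∈ (gr M).powerset, (if lo + δ ≤ (M.eRk ((gr M \ I : Finset α) : Set α)).toNat ∧
          (M.eRk ((gr M \ I : Finset α) : Set α)).toNat ≤ hi + δ then
          ((M.eRk ((gr M \ I : Finset α) : Set α)).toNat).choose δ else 0) := by
  refine pld_of_parallel_induction (fun _ => True) (fun _ _ _ _ _ _ _ => trivial) (fun _ _ _ _ _ _ _ => trivial)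
    ?_ M trivial
  -- the 2-circuit-free case: remove the loops one by one
  intro M _ _ hex
  suffices H : ∀ n : ℕ, ∀ (M : Matroid α) [M.Finite], (gr M).card = n →
      (¬ ∃ e e' : α, e ≠ e' ∧ M.IsCircuit {e, e'}) →
      ∀ lo hi δ Θ : ℕ, Θ ≤ lo + hi + δ → (lo = 0 ∨ lo + hi + δ ≤ Θ) →
      (∑ I ∈ (gr M).powerset, (if lo ≤ (M.eRk (I : Set α)).toNat ∧ (M.eRk (I : Set α)).toNat ≤ hi ∧
          Θ ≤ (M.eRk ((gr M \ I : Finset α) : Set α)).toNat + (M.eRk (I : Set α)).toNat then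
          ((M.eRk ((gr M \ I : Finset α) : Set α)).toNat).choose δ else 0)) ≤
        ∑ I ∈ (gr M).powerset, (if lo + δ ≤ (M.eRk ((gr M \ I : Finset α) : Set α)).toNat ∧
          (M.eRk ((gr M \ I : Finset α) : Set α)).toNat ≤ hi + δ then
          ((M.eRk ((gr M \ I : Finset α) : Set α)).toNat).choose δ else 0) from H _ M rfl hex
  intro n
  induction n using Nat.strong_induction_on with
  | _ n ih =>
  intro M _ hn hex
  by_cases hloop : ∃ e, M.IsLoop e
  · obtain ⟨e, he⟩ := hloop
    have heM : e ∈ gr M := by rw [← Finset.mem_coe, coe_gr]; exact he.mem_ground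
    have hcard : (gr (M ＼ {e})).card < n := by
      rw [gr_delete_singleton, ← hn]
      exact Finset.card_erase_lt_of_mem heM
    have hex' : ¬ ∃ a a' : α, a ≠ a' ∧ (M ＼ {e}).IsCircuit {a, a'} := by
      rintro ⟨a, a', haa, hC⟩
      exact hex ⟨a, a', haa, (Matroid.delete_isCircuit_iff.1 hC).1⟩
    exact pld_of_loop M he (ih _ hcard (M ＼ {e}) rfl hex')
  · push Not at hloop
    exact hsimple M hloop hex

end PLDParExt

end PercRepro
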